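/- Copyright: the b2b-balaban cell (near-miss cell 7), T⁴-continuum fan-out; row NE7b ROUND-2 swarm, seat
t4-ne7b-formalise-leaf-06 (gen 3) (road W-RP-VAR, row W4 «ASSEMBLY to the socket» of
`t4/b2b-balaban-t4-ne7b-p1/LEAVES-NE7b.md` v3.17, owner ruling R-OWNER-23-2 and owner spec v3.17; memo
`t4/b2b-balaban-t4-ne7-p2/g27/IDEAS-NE7-g27.md` §1, step S6).  Released under the licence of the surrounding project. -/
import Summits.QuantumFields.BalabanUV.T4Continuum.Support.HistoryChessboardDressing
import Summits.QuantumFields.BalabanUV.T4Continuum.Support.HistoryChessboardDensity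
import Summits.QuantumFields.BalabanUV.T4Continuum.Support.CountSeamJunction

/-!
# Road W-RP-VAR, row W4: ASSEMBLY — the chessboard readings of the two runs ⇒ `RelWeightBound` ⇒ `HybridNE7`

Summits-side support leaf of the T⁴-continuum cell (rung (B)+1 on a FINITE torus only; NOT infinite volume, NOT the
mass gap, NOT the Clay statement; NOT a proof of the spine estimate NE7b).  Row NE7b, road **W-RP-VAR** (owner's
ruling R-OWNER-23-2: a LIVE SECONDARY road beside the COUNT road of record), row **W4** of the claim table, typed to the
OWNER SPEC v3.17 («ABSTRACT ψ-CURRENCY, like the count road's sockets — every Bałaban-specific sentence is a DISPLAYED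
hypothesis read in the docstring, nothing instantiated»).  [folklore] bookkeeping over the cell's OWN records: it
composes, BY NAME, row W1 (`HistoryChessboardDressing`: reflection positivity is needed at `t = 0` only), row W2
(`HistoryChessboardDensity`: chessboard ⇒ per-cell density ⇒ union bound ⇒ summable budget, over the tree's
`Literature.Probability.LatticeModels.chessboard_pow_le_even`), the socket record `T4WeightBudget.RelWeightBound` and
the junction of record `CountSeamJunction.hybridNE7_of_eventually` (seam (ζ′) `hybridNE7_closure'_tail`).  Row W3
(`HistoryRPTensor`, the RP-tensor ∕ marginalisation lemma documenting where the Cauchy–Schwarz display comes from and why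
it FAILS for the printed corner prescription) is NOT imported, per the spec.  Nothing is quoted from Bałaban's papers,
nothing printed is asserted, no citation tag of the series, no `Prop`-valued FACT minted (trigger c1) and no `def`:
the one `structure … : Prop` below (`ChessboardReading`) is a HYPOTHESIS SHAPE consumed only as a binder — the socket
pattern of the count road's `HistorySocketTH.LiveHistoriesTH` — which puts the file in the gate's definition lane.

WHY (memo §1 «THE CHAIN», R-OWNER-23-2 (ii) W4).  The road produces NE7b's socket from DISPLAYED binders: (EXT) the
terms of one run at one cutoff are events of ONE positive (extended) measure and the bad class lies inside the union of
the single-CELL EVENTS of the `2^d` shifted tilings; (RP-ext)+(VAR) that measure — for the CENTRED averaging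
prescription — is reflection positive across block hyperplanes, (R-sym) the cell events are reflection-related; (U1)+(G2)
ONE bound of (0.1)-upper-half kind on the universally forced pattern against (B)'s global lower bound; (ARITH) the
per-cell rate is geometric in the forced depth, hence summable over the cutoff; `Even N`.  Then W2's density bound,
W1's dressing and the tree's tail packaging give `RelWeightBound`, and the seam gives `HybridNE7`.

WHAT — THE BINDERS, ONE STRUCTURE PER RUN (spec letters in brackets).  §1 `ChessboardReading d N P T a Bad ψ r K₀`: ONE
run, UNDRESSED weights `a K τ` (`:= A K 0 τ`), from the threshold `K₀` on; `P : Finset Λ` = the finite family of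
patterns (spec: the shifted tilings `s : Fin (2^d)`, i.e. `P = univ`, `#P = 2^d` — kept abstract, the only deviation
from the spec's letters, announced); `ψ K l` = the cell-pattern functional of pattern `l` at cutoff `K` on the block torus
`BlockIdx d N` (READING, docstring only: `ψ K l S = μ_ext,K(⋂_{c ∈ S} E_c^l) ∕ Z_K`, the normalised mass of «every cell
of `S` contains in its interior a pending chain of depth `≥ m_K`»); `r K` = the per-cell rate.  Fields: `bad_subset`,
`nonneg`; **`cover`** [`hcover`] = (EXT)∘(LOC) «bad mass ≤ (Σ_patterns Σ_cells single-cell density) × total mass»;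
**`psi_nonneg`∕`psi_empty`∕`cs`** [`h0`∕`hempty`∕`hcs`] = (RP-ext)+(VAR)+(R-sym) in Cauchy–Schwarz currency — the
hypotheses of `chessboard_pow_le_even`; the spec's `h1 : 0 < ψ univ` is NOT needed (row W2's primed forms carry the zero
case, leaf-10 g5 l.13098); **`univ_le`** [`huniv`] = (U1)+(G2) «`ψ K l univ ≤ (r K)^(N^d)`»; `r_nonneg`.
§2 the ENDs: **`ChessboardReading.sum_bad_le`** (one run, undressed: `Σ_{Bad K} a ≤ (#P·N^d·r K)·Σ_{T K} a` — W2's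
`sum_singleton_density_le_of_rp'` + `sum_sum_singleton_le` BY NAME); **`exists_relWeightBound_of_chessboard`** (two
runs with rates `r`, `r′` + W1's two-sided dressing + `Summable r`, `Summable r′` ⇒ `∃ K₁ ≥ K₀, RelWeightBound …`, bad
classes emptied below `K₁`, budget `𝟙_{K ≥ K₁}·e^{2m}·#P·N^d·(r K + r′ K)` — W1's `exists_relWeightBound_of_time_zero`
BY NAME, i.e. the tail packaging of `T4GlobalDenominator.exists_relWeightBound_of_globalDom`); **`hybridNE7_of_chessboard`**
(+ the NE7c socket `ShellWeightBound`, the NE7 budget `ReindexedBudget` on the hybrid cores, four summable rates ⇒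
`∃ K₁ ≥ K₀, ∃ K₂, HybridNE7` for the families shifted by `K₁ + K₂` — `CountSeamJunction.hybridNE7_of_eventually` BY NAME,
the COUNT road's exit shape verbatim).  §3 (ARITH) in the tree's currencies: **`hybridNE7_of_chessboard_geometric`** =
the END at the spec's rates `r K = c·ρ^{m K}`, `r′ K = c′·ρ^{m K}` given `Summable (fun K => ρ ^ m K)`;
`summable_pow_of_survivalRate` = that «given» DISCHARGED for the log window `m K = ⌈C·log (K+1)⌉₊` at
`ρ = e^{−σ}`, `σ = T4WeightBudget.survivalRate p E Nw L > 0`, `1 < C·σ` (W2's `summable_pow_ceil_log`); and the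
arithmetic of the (U1)∕(G2) split `univ_le_of_forced_of_lower` (numerator of (0.1)-upper-half kind ÷ global lower bound
= a per-cell rate to the number of cells).  §4 sanity: the reading is INHABITED (geometric toy `ψ S = q^{#S}`, whose
Cauchy–Schwarz field is the tree's `card_symP_add_card_symM`), a decided instance, a planted-false control.

HONEST SCOPE (R-OWNER-23-2 (iii), verbatim for this §W row): W-RP-VAR is a producer of NE7b's socket for the
CENTRED-AVERAGING VARIANT of the construction, NOT for Bałaban's printed corner prescription (for which reflection
positivity of the extended measure FAILS: B9 (1.6)–(1.7) ∕ B12 (2), memo F1, owner's negative (11c)); even complete, the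
road discharges NE7b only modulo (VAR) + (U1) + (G2) + (EXT)∕(RP-ext) DISPLAYED — here: the fields of `ChessboardReading`
—; the count 0∕9 is unchanged; nothing of H3 ∕ (B) ∕ BetaPertH is discharged; no exit ∕ socket ∕ `HistoryConstants` file
is touched (c3).  NE7b NOT proved; spine 0∕9.  HONEST DEPENDENCY (cell): continuum YM on T⁴ ⇐ BetaPertH ∧ nine spine
estimates (0/9 proved); BetaPertH ⇐ (D1) ∧ (D4) ∧ CAP+tail; G-an2-4 gates asym, D1 and NE2/3/4.  This file changes none
of it.
-/

open Finset
open Literature.MathematicalPhysics.QuantumFieldTheory.Balaban1983to89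
open Literature.MathematicalPhysics.QuantumFieldTheory.Balaban1983to89.T4WeightBudget
open Literature.MathematicalPhysics.QuantumFieldTheory.Balaban1983to89.T4IndicatorShell
open Literature.MathematicalPhysics.QuantumFieldTheory.Balaban1983to89.T4MatchingAssembly
open Literature.MathematicalPhysics.QuantumFieldTheory.Balaban1983to89.T4MatchingClosure
open Literature.Barriers.CriticalPhenomena.NonGibbs Literature.Probability.LatticeModels

namespace Summit.QuantumFields.BalabanUV.T4Continuum.HistoryChessboardAssembly

noncomputable section

/-! ## §1 The chessboard reading of ONE run (undressed, from a threshold on): the road's displayed binders -/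

section Reading

variable {ι Λ : Type*}

/-- **THE CHESSBOARD READING OF ONE RUN** (road W-RP-VAR; the displayed binders of the owner spec v3.17, row W4, in the
ψ-currency this assembly consumes).  Data: the block torus `BlockIdx d N` of cells (`N` per direction), a finite family
`P` of patterns (the `2^d` shifted tilings), the run's term families `T K` with UNDRESSED (`t = 0`) weights `a K τ`, its
bad classes `Bad K` (terms carrying old pending structure — a property of the term, constant in the source `t`), the
cell-pattern functionals `ψ K l : Finset (BlockIdx d N) → ℝ` (READING, not instantiated: `ψ K l S` = the normalised
mass, under the run's extended measure at cutoff `K`, of «every cell of `S` contains, in its interior, a pending chain of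
depth `≥ m_K`» for the tiling `l`), the per-cell rate `r K`, the threshold `K₀`.  Clauses, for `K ≥ K₀`:
* `bad_subset`, `nonneg` — the bad class consists of terms; undressed weights are nonnegative (I-2);
* `cover` [spec `hcover`] — (EXT)∘(LOC): the bad mass is at most the total single-cell density of the cell events, summed
  over the patterns, times the total mass (READ: terms are events of one positive measure partitioning its mass, every
  bad event lies inside a single-cell event of some shifted tiling, union bound — B15 (1.28)∕p.183 reading, displayed);
* `psi_nonneg`, `psi_empty`, `cs` [spec `h0`, `hempty`, `hcs`] — (RP-ext)+(VAR)+(R-sym) in Cauchy–Schwarz currency: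
  the hypotheses of the tree's chessboard estimate `chessboard_pow_le_even` for every pattern (READ: reflection
  positivity of the CENTRED-prescription extended measure across every block hyperplane, cell events measurable in their
  half and reflection-related — NEW-UNPRINTED; it FAILS for the printed corner prescription; row W3 documents it);
* `univ_le`, `r_nonneg` [spec `huniv`] — (U1)+(G2): the universally forced pattern has density `≤ (r K)^(N^d)` (READ: a
  (0.1)-upper-half-KIND bound on the numerator against (B)'s global lower bound, per cell; §3
  `univ_le_of_forced_of_lower` is the arithmetic of that split).
A hypothesis SHAPE over abstract finite families; NOTHING of Bałaban's is asserted; no citation tag (nothing printed is stated). [folklore] -/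
structure ChessboardReading (d N : ℕ) [NeZero N] (P : Finset Λ) (T : ℕ → Finset ι) (a : ℕ → ι → ℝ)
    (Bad : ℕ → Finset ι) (ψ : ℕ → Λ → Finset (BlockIdx d N) → ℝ) (r : ℕ → ℝ) (K₀ : ℕ) : Prop where
  /-- the bad class consists of terms -/
  bad_subset : ∀ K, K₀ ≤ K → Bad K ⊆ T K
  /-- undressed term weights are nonnegative (I-2: events of a positive measure) -/
  nonneg : ∀ K, K₀ ≤ K → ∀ τ ∈ T K, 0 ≤ a K τ
  /-- (EXT)∘(LOC) [spec `hcover`]: bad mass ≤ (Σ over patterns and cells of the single-cell densities) × total mass -/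
  cover : ∀ K, K₀ ≤ K →
    ∑ τ ∈ Bad K, a K τ ≤ (∑ l ∈ P, ∑ c : BlockIdx d N, ψ K l {c}) * ∑ τ ∈ T K, a K τ
  /-- [spec `h0`] the cell-pattern functional is nonnegative -/
  psi_nonneg : ∀ K, K₀ ≤ K → ∀ l ∈ P, ∀ S, 0 ≤ ψ K l S
  /-- [spec `hempty`] the empty pattern has density at most one (it IS one for a normalised state) -/
  psi_empty : ∀ K, K₀ ≤ K → ∀ l ∈ P, ψ K l ∅ ≤ 1
  /-- (RP-ext)+(VAR)+(R-sym) [spec `hcs`]: reflection Cauchy–Schwarz for every block reflection `(i, k)` -/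
  cs : ∀ K, K₀ ≤ K → ∀ l ∈ P, ∀ (i : Fin d) (k : ZMod N) (S : Finset (BlockIdx d N)),
    ψ K l S ^ 2 ≤ ψ K l (symP i k S) * ψ K l (symM i k S)
  /-- (U1)+(G2) [spec `huniv`]: the universally forced pattern has density `≤ (r K)^(N^d)` -/
  univ_le : ∀ K, K₀ ≤ K → ∀ l ∈ P, ψ K l univ ≤ r K ^ (N ^ d)
  /-- the per-cell rate is nonnegative -/
  r_nonneg : ∀ K, K₀ ≤ K → 0 ≤ r K

end Reading

/-! ## §2 The ENDs: one run undressed; two runs dressed ⇒ the socket; the socket ⇒ `HybridNE7` by the junction -/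

section Ends

variable {ι Λ : Type*} {d N : ℕ} [NeZero N] {P : Finset Λ} {T : ℕ → Finset ι} {K₀ : ℕ} {r r' : ℕ → ℝ}

/-- **ONE RUN, UNDRESSED: THE BAD CLASS HAS RELATIVE WEIGHT `≤ #P · N^d · r K`** from `K₀` on (even `N`).  Proof:
`cover`, then row W2's `sum_singleton_density_le_of_rp'` (chessboard ⇒ `ψ {c} ≤ r K` per cell; its zero case needs no
positivity hypothesis) summed over the `N^d` cells and, by `sum_sum_singleton_le`, over the patterns. [folklore] -/
theorem ChessboardReading.sum_bad_le {a : ℕ → ι → ℝ} {Bad : ℕ → Finset ι}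
    {ψ : ℕ → Λ → Finset (BlockIdx d N) → ℝ} (H : ChessboardReading d N P T a Bad ψ r K₀) (hN : Even N)
    {K : ℕ} (hK : K₀ ≤ K) :
    ∑ τ ∈ Bad K, a K τ ≤ ((#P : ℝ) * (N : ℝ) ^ d * r K) * ∑ τ ∈ T K, a K τ := by
  have hcells : ∑ l ∈ P, ∑ c : BlockIdx d N, ψ K l {c} ≤ (N : ℝ) ^ d * ∑ l ∈ P, r K :=
    HistoryChessboardDensity.sum_sum_singleton_le P fun l hl =>
      HistoryChessboardDensity.sum_singleton_density_le_of_rp' hN (H.psi_nonneg K hK l hl) (H.psi_empty K hK l hl)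
        (H.cs K hK l hl) (H.r_nonneg K hK) (H.univ_le K hK l hl)
  have htot : 0 ≤ ∑ τ ∈ T K, a K τ := sum_nonneg (H.nonneg K hK)
  calc ∑ τ ∈ Bad K, a K τ ≤ (∑ l ∈ P, ∑ c : BlockIdx d N, ψ K l {c}) * ∑ τ ∈ T K, a K τ := H.cover K hK
    _ ≤ ((N : ℝ) ^ d * ∑ l ∈ P, r K) * ∑ τ ∈ T K, a K τ := mul_le_mul_of_nonneg_right hcells htot
    _ = ((#P : ℝ) * (N : ℝ) ^ d * r K) * ∑ τ ∈ T K, a K τ := by rw [sum_const, nsmul_eq_mul]; ring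

/-- … hence `≤ w · Σ_{T K} a` for every larger relative weight `w ≥ #P·N^d·r K` (the total mass is nonnegative).
[folklore] -/
theorem ChessboardReading.sum_bad_le_of_le {a : ℕ → ι → ℝ} {Bad : ℕ → Finset ι}
    {ψ : ℕ → Λ → Finset (BlockIdx d N) → ℝ} (H : ChessboardReading d N P T a Bad ψ r K₀) (hN : Even N)
    {K : ℕ} (hK : K₀ ≤ K) {w : ℝ} (hw : (#P : ℝ) * (N : ℝ) ^ d * r K ≤ w) :
    ∑ τ ∈ Bad K, a K τ ≤ w * ∑ τ ∈ T K, a K τ :=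
  (H.sum_bad_le hN hK).trans (mul_le_mul_of_nonneg_right hw (sum_nonneg (H.nonneg K hK)))

variable {l₀ m : ℝ} {A B : ℕ → ℝ → ι → ℝ} {Bad : ℕ → Finset ι} {ψA ψB : ℕ → Λ → Finset (BlockIdx d N) → ℝ}

/-- The two-run relative weight `#P·N^d·(r K + r′ K)` dominates each run's own and is nonnegative, from `K₀` on.
[folklore] -/
theorem weight_le_and_nonneg (HA : ChessboardReading d N P T (fun K => A K 0) Bad ψA r K₀)
    (HB : ChessboardReading d N P T (fun K => B K 0) Bad ψB r' K₀) {K : ℕ} (hK : K₀ ≤ K) :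
    (#P : ℝ) * (N : ℝ) ^ d * r K ≤ (#P : ℝ) * (N : ℝ) ^ d * (r K + r' K) ∧
      (#P : ℝ) * (N : ℝ) ^ d * r' K ≤ (#P : ℝ) * (N : ℝ) ^ d * (r K + r' K) ∧
      0 ≤ (#P : ℝ) * (N : ℝ) ^ d * (r K + r' K) := by
  have hr := HA.r_nonneg K hK
  have hr' := HB.r_nonneg K hK
  have hc : 0 ≤ (#P : ℝ) * (N : ℝ) ^ d := by positivity
  exact ⟨mul_le_mul_of_nonneg_left (le_add_of_nonneg_right hr') hc,
    mul_le_mul_of_nonneg_left (le_add_of_nonneg_left hr) hc, mul_nonneg hc (add_nonneg hr hr')⟩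

/-- **TWO RUNS, DRESSED: THE SOCKET** (spec conclusion).  The chessboard readings of both runs' `t = 0` weights (same
patterns, bad classes and threshold; run A with rate `r` and functionals `ψA`, run B with `r′`, `ψB`), SUMMABLE rates,
and W1's two-sided dressing of every term against its own `t = 0` value on the source window (`e^{−m}·X K 0 τ ≤ X K t τ ≤
e^{m}·X K 0 τ` for `|t| ≤ l₀`, `K ≥ K₀`, `X = A, B`; read `m = l₀·‖obs‖_∞`) give SOME `RelWeightBound` for the dressed
families: bad classes emptied below a threshold `K₁ ≥ K₀`, budget `W K = 𝟙_{K ≥ K₁}·e^{2m}·#P·N^d·(r K + r′ K)` — row W1's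
`exists_relWeightBound_of_time_zero` (tail packaging of `T4GlobalDenominator.exists_relWeightBound_of_globalDom`: the
first `K₁` from which the budget is `< 1`) on §2's one-run bounds.  CONDITIONAL on the readings; nothing PRINTED is
asserted. [folklore] -/
theorem exists_relWeightBound_of_chessboard (hN : Even N)
    (HA : ChessboardReading d N P T (fun K => A K 0) Bad ψA r K₀)
    (HB : ChessboardReading d N P T (fun K => B K 0) Bad ψB r' K₀) (hr : Summable r) (hr' : Summable r')
    (hAd : ∀ K t, |t| ≤ l₀ → K₀ ≤ K → ∀ τ ∈ T K,
      Real.exp (-m) * A K 0 τ ≤ A K t τ ∧ A K t τ ≤ Real.exp m * A K 0 τ)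
    (hBd : ∀ K t, |t| ≤ l₀ → K₀ ≤ K → ∀ τ ∈ T K,
      Real.exp (-m) * B K 0 τ ≤ B K t τ ∧ B K t τ ≤ Real.exp m * B K 0 τ) :
    ∃ K₁, K₀ ≤ K₁ ∧ RelWeightBound l₀ T A B (fun K _ => if K₁ ≤ K then Bad K else ∅)
      (Set.indicator {K | K₁ ≤ K} (fun K => Real.exp (2 * m) * ((#P : ℝ) * (N : ℝ) ^ d * (r K + r' K)))) :=
  HistoryChessboardDressing.exists_relWeightBound_of_time_zero HA.bad_subset
    (fun _ hK => (weight_le_and_nonneg HA HB hK).2.2) ((hr.add hr').mul_left _)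
    (fun _ hK => HA.sum_bad_le_of_le hN hK (weight_le_and_nonneg HA HB hK).1)
    (fun _ hK => HB.sum_bad_le_of_le hN hK (weight_le_and_nonneg HA HB hK).2.1) hAd hBd

variable [DecidableEq ι] {vol : ℝ} {shA shB Cc Rr CcRec RrRec : ℕ → ℝ → ι → ℝ} {ν u s₂ c₀ rr s Wsh : ℕ → ℝ}

/-- **THE ROAD'S END: `HybridNE7` FROM THE CHESSBOARD READINGS** (node U5, seam (ζ′); spec §2).  The two runs'
chessboard readings at `t = 0` (even `N`, summable rates), W1's two-sided dressing on the source window, the NE7c socket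
`ShellWeightBound`, the NE7 budget `ReindexedBudget` on the hybrid cores (bad classes constant in `t`) and four summable
rates give `HybridNE7` for the families shifted by `K₁ + K₂`, some `K₁ ≥ K₀` and `K₂`, with the weight
`e^{2m}·#P·N^d·(r + r′)` — the COUNT road's exit shape, through the junction of record
`CountSeamJunction.hybridNE7_of_eventually` (shift by `K₁`, then `T4MatchingClosureSocket.hybridNE7_closure'_tail`).  Every
input is a binder; nothing PRINTED is asserted; NE7b is NOT proved by this (the readings are displayed). [folklore] -/
theorem hybridNE7_of_chessboard (hN : Even N)
    (HA : ChessboardReading d N P T (fun K => A K 0) Bad ψA r K₀)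
    (HB : ChessboardReading d N P T (fun K => B K 0) Bad ψB r' K₀) (hr : Summable r) (hr' : Summable r')
    (hAd : ∀ K t, |t| ≤ l₀ → K₀ ≤ K → ∀ τ ∈ T K,
      Real.exp (-m) * A K 0 τ ≤ A K t τ ∧ A K t τ ≤ Real.exp m * A K 0 τ)
    (hBd : ∀ K t, |t| ≤ l₀ → K₀ ≤ K → ∀ τ ∈ T K,
      Real.exp (-m) * B K 0 τ ≤ B K t τ ∧ B K t τ ≤ Real.exp m * B K 0 τ)
    (hSh : ShellWeightBound l₀ T A B shA shB Wsh)
    (hTB : ReindexedBudget l₀ vol T (fun K t τ => A K t τ - shA K t τ) (fun K t τ => B K t τ - shB K t τ)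
      (fun K _ => Bad K) Cc Rr CcRec RrRec ν u s₂ c₀ rr s)
    (hrr : Summable rr) (hu : Summable u) (hs : Summable s) (hs₂ : Summable s₂) :
    ∃ K₁ K₂, K₀ ≤ K₁ ∧ HybridNE7 l₀ vol (fun K => T (K₁ + (K₂ + K))) (fun K => A (K₁ + (K₂ + K)))
      (fun K => B (K₁ + (K₂ + K))) (fun K _ => Bad (K₁ + (K₂ + K)))
      (fun K => Real.exp (2 * m) * ((#P : ℝ) * (N : ℝ) ^ d * (r (K₁ + (K₂ + K)) + r' (K₁ + (K₂ + K)))))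
      (fun K => shA (K₁ + (K₂ + K))) (fun K => shB (K₁ + (K₂ + K))) (fun K => Wsh (K₁ + (K₂ + K)))
      (fun K => (rr (K₁ + (K₂ + K)) + u (K₁ + (K₂ + K))) + (s (K₁ + (K₂ + K)) + s₂ (K₁ + (K₂ + K)))) :=
  CountSeamJunction.hybridNE7_of_eventually (exists_relWeightBound_of_chessboard hN HA HB hr hr' hAd hBd) hSh hTB hrr
    hu hs hs₂

end Ends

/-! ## §3 (ARITH): geometric rates, the survival∕window junction, the (U1)∕(G2) split — in the tree's currencies -/

section Arith

variable {ι Λ : Type*} [DecidableEq ι] {d N : ℕ} [NeZero N] {P : Finset Λ} {T : ℕ → Finset ι} {K₀ : ℕ}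
  {l₀ m vol : ℝ} {A B shA shB Cc Rr CcRec RrRec : ℕ → ℝ → ι → ℝ} {Bad : ℕ → Finset ι}
  {ψA ψB : ℕ → Λ → Finset (BlockIdx d N) → ℝ} {ν u s₂ c₀ rr s Wsh : ℕ → ℝ} {ρ c c' : ℝ} {mK : ℕ → ℕ}

/-- **THE END AT GEOMETRIC RATES** (spec (U1)+(G2)+(ARITH) letters): `hybridNE7_of_chessboard` with the per-cell rates
`r K = c·ρ^{m K}`, `r′ K = c′·ρ^{m K}` (per-cell slack `c = e^{c_sl·(2ℓ)^d}`-type constants, `ρ` the survival rate,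
`m K` the depth forced by the age `≥ K − j⋆(K)` over the windows — all DISPLAYED), given `Summable (fun K => ρ ^ m K)`
(W2's `summable_budget`; for the log window see `summable_pow_of_survivalRate`). [folklore] -/
theorem hybridNE7_of_chessboard_geometric (hN : Even N)
    (HA : ChessboardReading d N P T (fun K => A K 0) Bad ψA (fun K => c * ρ ^ mK K) K₀)
    (HB : ChessboardReading d N P T (fun K => B K 0) Bad ψB (fun K => c' * ρ ^ mK K) K₀)
    (hρ : Summable fun K => ρ ^ mK K)
    (hAd : ∀ K t, |t| ≤ l₀ → K₀ ≤ K → ∀ τ ∈ T K,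
      Real.exp (-m) * A K 0 τ ≤ A K t τ ∧ A K t τ ≤ Real.exp m * A K 0 τ)
    (hBd : ∀ K t, |t| ≤ l₀ → K₀ ≤ K → ∀ τ ∈ T K,
      Real.exp (-m) * B K 0 τ ≤ B K t τ ∧ B K t τ ≤ Real.exp m * B K 0 τ)
    (hSh : ShellWeightBound l₀ T A B shA shB Wsh)
    (hTB : ReindexedBudget l₀ vol T (fun K t τ => A K t τ - shA K t τ) (fun K t τ => B K t τ - shB K t τ)
      (fun K _ => Bad K) Cc Rr CcRec RrRec ν u s₂ c₀ rr s)
    (hrr : Summable rr) (hu : Summable u) (hs : Summable s) (hs₂ : Summable s₂) :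
    ∃ K₁ K₂, K₀ ≤ K₁ ∧ HybridNE7 l₀ vol (fun K => T (K₁ + (K₂ + K))) (fun K => A (K₁ + (K₂ + K)))
      (fun K => B (K₁ + (K₂ + K))) (fun K _ => Bad (K₁ + (K₂ + K)))
      (fun K => Real.exp (2 * m) * ((#P : ℝ) * (N : ℝ) ^ d *
        (c * ρ ^ mK (K₁ + (K₂ + K)) + c' * ρ ^ mK (K₁ + (K₂ + K)))))
      (fun K => shA (K₁ + (K₂ + K))) (fun K => shB (K₁ + (K₂ + K))) (fun K => Wsh (K₁ + (K₂ + K)))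
      (fun K => (rr (K₁ + (K₂ + K)) + u (K₁ + (K₂ + K))) + (s (K₁ + (K₂ + K)) + s₂ (K₁ + (K₂ + K)))) :=
  hybridNE7_of_chessboard hN HA HB (HistoryChessboardDensity.summable_budget hρ)
    (HistoryChessboardDensity.summable_budget hρ) hAd hBd hSh hTB hrr hu hs hs₂

/-- **THE SURVIVAL∕WINDOW JUNCTION** (`T4WeightBudget.survivalRate` currency): with the net survival rate per step
`σ := survivalRate p E Nw L = (p − E)∕Nw − 4·log L` POSITIVE (`T4WeightBudget.survivalRate_pos_iff`: «`p∕Nw > 4·log L +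
E∕Nw`») and the log window `m K = ⌈C·log (K+1)⌉₊` with `1 < C·σ`, the «given» of `hybridNE7_of_chessboard_geometric` is
DISCHARGED at `ρ = e^{−σ}`: `K ↦ (e^{−σ})^{⌈C·log (K+1)⌉₊}` is summable (W2's `summable_pow_ceil_log`, `log ρ⁻¹ = σ`).
[folklore] -/
theorem summable_pow_of_survivalRate {p E Nw L C : ℝ} (hσ : 0 < survivalRate p E Nw L) (hC : 0 ≤ C)
    (hCσ : 1 < C * survivalRate p E Nw L) :
    Summable fun K : ℕ => Real.exp (-survivalRate p E Nw L) ^ ⌈C * Real.log ((K : ℝ) + 1)⌉₊ := by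
  have h0 : 0 < Real.exp (-survivalRate p E Nw L) := Real.exp_pos _
  have h1 : Real.exp (-survivalRate p E Nw L) < 1 := Real.exp_lt_one_iff.2 (neg_lt_zero.2 hσ)
  have hlog : Real.log (Real.exp (-survivalRate p E Nw L))⁻¹ = survivalRate p E Nw L := by
    rw [Real.log_inv, Real.log_exp, neg_neg]
  exact HistoryChessboardDensity.summable_pow_ceil_log h0 h1 hC (by rwa [hlog])

/-- `0 ≤ e^{−σ} < 1` for a positive survival rate `σ` (the rate letters of the spec). [folklore] -/
theorem exp_neg_survivalRate_nonneg_lt_one {p E Nw L : ℝ} (hσ : 0 < survivalRate p E Nw L) :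
    0 ≤ Real.exp (-survivalRate p E Nw L) ∧ Real.exp (-survivalRate p E Nw L) < 1 :=
  ⟨(Real.exp_pos _).le, Real.exp_lt_one_iff.2 (neg_lt_zero.2 hσ)⟩

/-- **THE (U1)∕(G2) SPLIT OF THE UNIVERSAL BOUND** (arithmetic only).  If the numerator of the universally forced
pattern is bounded in the (0.1)-upper-half KIND, `M ≤ e^{Ep·vol}·q^n` (`n` cells, `q` the per-cell chain rate), the
denominator from below in the (0.1)-lower-half kind ((B) at `k = K`), `e^{−Em·vol}·z₀^{vol} ≤ Z` with `0 < z₀`, and the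
volume is `vol = n·w` (`w` sites per cell), then the ratio is a per-cell rate to the number of cells:
`M ∕ Z ≤ (e^{(Ep+Em)·w}·(z₀⁻¹)^w·q)^n` — the field `univ_le` of `ChessboardReading` with per-cell rate
`r = e^{(Ep+Em)·w}·(z₀⁻¹)^w·q` (stability slack per cell × chain rate). [folklore] -/
theorem univ_le_of_forced_of_lower {M Z Ep Em z₀ q : ℝ} {n w vol : ℕ} (hvol : vol = n * w) (hz₀ : 0 < z₀)
    (hq : 0 ≤ q) (hM : M ≤ Real.exp (Ep * vol) * q ^ n) (hZ : Real.exp (-(Em * vol)) * z₀ ^ vol ≤ Z) :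
    M / Z ≤ (Real.exp ((Ep + Em) * w) * z₀⁻¹ ^ w * q) ^ n := by
  have hZ0 : 0 < Real.exp (-(Em * vol)) * z₀ ^ vol := mul_pos (Real.exp_pos _) (pow_pos hz₀ _)
  have hZpos : 0 < Z := hZ0.trans_le hZ
  rw [div_le_iff₀ hZpos]
  -- the right-hand side times the LOWER bound of `Z` is exactly the UPPER bound of `M`
  have key : (Real.exp ((Ep + Em) * w) * z₀⁻¹ ^ w * q) ^ n * (Real.exp (-(Em * vol)) * z₀ ^ vol) =
      Real.exp (Ep * vol) * q ^ n := by
    have hz : z₀ ≠ 0 := hz₀.ne'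
    have e1 : Real.exp ((Ep + Em) * w) ^ n * Real.exp (-(Em * vol)) = Real.exp (Ep * vol) := by
      rw [← Real.exp_nat_mul, ← Real.exp_add, hvol]
      push_cast
      ring_nf
    have e2 : (z₀⁻¹ ^ w) ^ n * z₀ ^ vol = 1 := by
      rw [← pow_mul, hvol, mul_comm n w, inv_pow, inv_mul_cancel₀ (pow_ne_zero _ hz)]
    calc (Real.exp ((Ep + Em) * w) * z₀⁻¹ ^ w * q) ^ n * (Real.exp (-(Em * vol)) * z₀ ^ vol)
        = (Real.exp ((Ep + Em) * w) ^ n * Real.exp (-(Em * vol))) * ((z₀⁻¹ ^ w) ^ n * z₀ ^ vol) * q ^ n := by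
          rw [mul_pow, mul_pow]; ring
      _ = Real.exp (Ep * vol) * q ^ n := by rw [e1, e2, mul_one]
  calc M ≤ Real.exp (Ep * vol) * q ^ n := hM
    _ = (Real.exp ((Ep + Em) * w) * z₀⁻¹ ^ w * q) ^ n * (Real.exp (-(Em * vol)) * z₀ ^ vol) := key.symm
    _ ≤ (Real.exp ((Ep + Em) * w) * z₀⁻¹ ^ w * q) ^ n * Z :=
        mul_le_mul_of_nonneg_left hZ (pow_nonneg (by positivity) _)

end Arith

/-! ## §4 Sanity: the reading is inhabited; a decided instance; a planted-false control -/

namespace Sanity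

/-- THE GEOMETRIC TOY functional `S ↦ q^{#S}` satisfies reflection Cauchy–Schwarz WITH EQUALITY on every even block
torus: `#symP S + #symM S = 2·#S` (the tree's `card_symP_add_card_symM`). -/
theorem geometric_cs {d N : ℕ} [NeZero N] (hN : Even N) (q : ℝ) (i : Fin d) (k : ZMod N)
    (S : Finset (BlockIdx d N)) :
    (q ^ #S) ^ 2 ≤ q ^ #(symP i k S) * q ^ #(symM i k S) := by
  rw [← pow_add, card_symP_add_card_symM hN, ← pow_mul, mul_comm]

/-- NON-VACUITY: the chessboard reading is INHABITED — one pattern, two terms `{true, false}` of undressed weight `1`,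
bad class `{true}`, the geometric toy `ψ S = (1∕2)^{#S}` on the block torus `(ℤ∕2)^1` (two cells), rate `r = 1∕2`:
`cover` reads `1 ≤ (½ + ½)·2`, `univ_le` reads `(½)^2 ≤ (½)^(2^1)`. -/
example : ChessboardReading 1 2 ({()} : Finset Unit) (fun _ => ({true, false} : Finset Bool)) (fun _ _ => (1 : ℝ))
    (fun _ => {true}) (fun _ _ S => (1 / 2 : ℝ) ^ #S) (fun _ => 1 / 2) 0 where
  bad_subset _ _ := by simp
  nonneg _ _ _ _ := by norm_num
  cover _ _ := by
    have hcard : (Finset.univ : Finset (BlockIdx 1 2)).card = 2 := by simp [BlockIdx, ZMod.card]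
    simp only [card_singleton, pow_one, sum_const, hcard]
    norm_num
  psi_nonneg _ _ _ _ S := by positivity
  psi_empty _ _ _ _ := by simp
  cs _ _ _ _ i k S := geometric_cs (by decide) _ i k S
  univ_le _ _ _ _ := by
    have hcard : (Finset.univ : Finset (BlockIdx 1 2)).card = 2 ^ 1 := by simp [BlockIdx, ZMod.card]
    rw [hcard]
  r_nonneg _ _ := by norm_num

/-- DECIDED INSTANCE of the arithmetic behind §2 (`#P = 1`, `N^d = 2`, `r = 1∕2`, total mass `2`, bad mass `1`):
the one-run bound reads `1 ≤ (1·2·½)·2`. -/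
example : (1 : ℝ) ≤ ((1 : ℝ) * (2 : ℝ) ^ 1 * (1 / 2)) * 2 := by norm_num

/-- CONTROL (planted false): the (U1)∕(G2) split needs the LOWER bound on the denominator — with `Z` free, `M ≤ 1`
alone bounds no ratio (`M = 1`, `Z = 1∕4`: the ratio is `4 > 1`). -/
example : ¬ ∀ M Z : ℝ, 0 < Z → M ≤ 1 → M / Z ≤ 1 := by
  intro h
  have := h 1 (1/4) (by norm_num) le_rfl
  norm_num at this

end Sanity

end

end Summit.QuantumFields.BalabanUV.T4Continuum.HistoryChessboardAssembly
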